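import Literature.NumberTheory.Automorphic.SymplecticSimilitudeSatakeWeylInvariance
import HarnessLib

/-!
# The Satake transform of `T(p)` for `GSp_{2n}` in every rank: `𝒮_q(T(p)) = q^{n(n+1)/2} · x_0 ∏_{i=1}^{n} (1 + x_i)`
# (Andrianov–Zhuravlev (3.70): `Ω(T(p)) = x_0 ∏ (1 + x_i) = t`), its `2ⁿ` left-coset counts `q^{Σ_{i∉I}(n-i)}` and the
# degree `deg T(p) = ∏_{j=1}^{n} (1 + q^j)`

Topic `NumberTheory/Automorphic`; namespace `Literature.NumberTheory.Automorphic.SymplecticCartan` (lane `lit-hodgefound`,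
Track 2 foundations; seat `lit-hodgefound-p11`, generation 51, row g51-#3).  THEOREMS ONLY: no definition, no named fact, no
instance, no notation.  Sequel of `SymplecticSimilitudeSatakeWeylInvariance` (g51-#2: `𝒮_q(T)` is `W(GSp_{2n})`-invariant and
the counting identity `N(wλ) q^{E⁺} = N(λ) q^{(-E)⁺}`), the tree's one-coset top term
(`card_filter_similitudeIwasawaExp_orbit_eq_one`, `coeff_self_similitudeSatakeTransform_torusElt`) and its triangularity
(`headSum_le_of_coeff_similitudeSatakeTransform_ne_zero`, `snd_eq_of_coeff_similitudeSatakeTransform_ne_zero`).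

## The mathematics

`G = GSp(J, K)`, `K₀ = GSp(J, 𝒪)` (`q = #𝓀`), `T(p) = T_{t(1,0)} = [K₀ diag(ϖ·1; 1) K₀]` — Andrianov–Zhuravlev's
`T(p) = (Γ diag(E_n, pE_n) Γ)` ((3.19), the generator `h_{n-1}` of the tree's `SymplecticSimilitudeHeckeAlgebraStructure`), with
exponents `(a, c)(t(1,0)) = ((1,…,1), 1)`.  [AndrianovZhuravlev1995] Lemma 3.32 ((3.58)–(3.59): `T(p) = Σ_a Π_a`, left cosets
`(p D* B; 0 D)`, `D ∈ Λ D_a Λ`, `B ∈ B_0(D)/mod D`), Lemma 3.33 (`b_0(D_a) = p^{⟨a⟩}`), Lemma 3.34 (`Ω(Π_a) = x_0 s_a(x_1,…,x_n)`)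
and (3.70): **`Ω(T(p)) = Σ_a x_0 s_a(x_1, …, x_n) = x_0 ∏_{i=1}^{n} (1 + x_i) = t`**.  In the tree's normalisation
(`𝒮_q(T_g)_λ = N(λ) q^{⟨ρ, λ₁⟩}`, `N(λ) = #{γ ∈ K₀gK₀/K₀ : (a,c)(γ) = λ}`, `ρ = (n, …, 1)`; A–Z's `Ω` divides by `p^{⟨n⟩}`-type
factors, (3.46)–(3.49)) this reads, for EVERY commutative ring `R` with `(q : R) = #𝓀` a unit:

  **`𝒮_q(T(p)) = q^{⟨ρ,(1,…,1)⟩} · x^{(0,1)} ∏_{i} (1 + x^{(e_i, 0)}) = q^{n(n+1)/2} Σ_{I ⊆ [n]} x^{(𝟙_I, 1)}`**   (`similitudeSatakeTransform_Tp`).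

PROOF (from the Weyl-group invariance rather than A–Z's coset expansion): the top exponent `((1,…,1), 1)` is carried by exactly
one coset (Bruhat–Tits (4.4.4) (ii)), so its coefficient is `q^{⟨ρ, 1⟩}`; the sign vector `ε_I` of `W(GSp_{2n})` moves it to
`(𝟙_I, 1)`, so all `2ⁿ` coefficients are `q^{⟨ρ,1⟩}`; and nothing else occurs: `c = 1` (multiplier), `μ_i ≤ 1` (triangularity,
first head sum, after permuting `i` to the front) and `μ_i ≥ 0` (the same after `τ_i : μ_i ↦ 1 - μ_i`).  CONSEQUENCES: the
LEFT-COSET COUNTS **`N(𝟙_I, 1) = q^{⟨ρ,1⟩ - ⟨ρ,𝟙_I⟩} = q^{Σ_{i ∉ I}(n - i)}`** (`I = ∅`: the `q^{n(n+1)/2}` cosets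
`(E B; 0 pE)`, `B` symmetric mod `p`; A–Z's `b_0`/`Π_a` counts summed over `D`), every coset of `K₀ t(1,0) K₀` has exponents of this
form, and the DEGREE **`deg T(p) = #(K₀ t(1,0) K₀/K₀) = Σ_I q^{Σ_{i∉I}(n-i)} = ∏_{j=1}^{n} (1 + q^j)`** (`n = 1`: `1 + q`,
`n = 2`: `(1 + q)(1 + q²) = 1 + q + q² + q³`).

## What is formalised

* §1 `similitudeIwasawaExp_similitudeTorusElt_one_zero`, `coe_coe_similitudeTorusElt_one_zero` (`t(1,0) = diag(ϖ·1; 1)`),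
  **`coeff_similitudeSatakeTransform_Tp_top`** (`= q^{⟨ρ,1⟩}`), `card_filter_similitudeIwasawaExp_Tp_top` (`= 1`).
* §2 `similitudeSignedPermEquiv_indicator_apply_top`, **`coeff_similitudeSatakeTransform_Tp_indicator`** (`(𝟙_I, 1) ↦ q^{⟨ρ,1⟩}`),
  **`eq_of_coeff_similitudeSatakeTransform_Tp_ne_zero`** (support `⊆ {0,1}ⁿ × {1}`), `coeff_similitudeSatakeTransform_Tp_eq_zero`.
* §3 `single_zero_one_mul_prod_one_add_single` (`x_0 ∏ (1 + x_i) = Σ_I x^{(𝟙_I,1)}`), **`similitudeSatakeTransform_Tp`** (A–Z (3.70)).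
* §4 `symplecticRhoPairing_one_sub_indicator`, **`card_filter_similitudeIwasawaExp_Tp_indicator`** (`N(𝟙_I,1) = q^{Σ_{i∉I}(n-i)}`),
  `similitudeIwasawaExp_out_eq_indicator_of_mem_orbit_Tp`, `sum_pow_sum_compl_eq_prod`, **`card_orbit_Tp`**
  (`deg T(p) = ∏_{j=1}^{n}(1 + q^j)`), `similitudeHeckeEigencharacter_one_one_Tp`.

## References
* [AndrianovZhuravlev1995] A. N. Andrianov, V. G. Zhuravlev, *Modular Forms and Hecke Operators*, Transl. Math. Monogr. 145
  (1995), Ch. 3 §3 (3.19), §3.3 (3.44)–(3.51), (3.54), Lemma 3.32 ((3.58)–(3.59)), Lemma 3.33, Lemma 3.34, Thm. 3.30 and its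
  proof (3.70), Prop. 3.36.
* [CartierCorvallis1979] P. Cartier, *Representations of 𝔭-adic groups: a survey*, PSPM 33.1 (1979), §IV (4.2), Thm. 4.1 (b).
* [BruhatTits1972] F. Bruhat, J. Tits, *Groupes réductifs sur un corps local I*, Publ. Math. IHÉS 41 (1972), Prop. (4.4.4) (i), (ii).
* [ShimuraIATAF1971] G. Shimura, *Introduction to the Arithmetic Theory of Automorphic Functions* (1971), §3.1, Prop. 3.15.
-/

noncomputable section

open scoped Valued WithZero MatrixGroups
open Matrix MonoidAlgebra Representation MulAction Finset

namespace Literature.NumberTheory.Automorphic.SymplecticCartan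

open Literature.NumberTheory.Automorphic Literature.NumberTheory.Automorphic.CartanUnique
  Literature.NumberTheory.Automorphic.HermitianLattice

variable {K : Type*} [Field K] [Valued K ℤᵐ⁰] {ϖ : K} {n : ℕ} [NeZero n] {R : Type*} [CommRing R]

/-! ## §1 The operator `T(p) = T_{t(1, 0)}`: exponents and the top coefficient -/

omit [Valued K ℤᵐ⁰] [NeZero n] in
/-- `∑_{i} [i < 1] f i = f 0`. [folklore] -/
private theorem sum_ite_lt_one_eq (f : Fin n → ℤ) [NeZero n] : (∑ i : Fin n, if (i : ℕ) < 1 then f i else 0) = f 0 := by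
  rw [Finset.sum_eq_single (0 : Fin n)]
  · simp
  · intro i _ hi
    rw [if_neg]
    intro h
    exact hi (Fin.ext (by simp only [Fin.val_zero]; omega))
  · intro h; exact absurd (Finset.mem_univ _) h

/-- **The exponents of `t(1, 0) = diag(ϖ·1; 1)`** are `((1, …, 1), 1)`. [cite: AndrianovZhuravlev1995, Ch. 3 §3.3 (3.44)–(3.46), Lemma 3.32] -/
theorem similitudeIwasawaExp_similitudeTorusElt_one_zero (hϖ : Valued.v ϖ = WithZero.exp (-1 : ℤ)) :
    similitudeIwasawaExp hϖ (similitudeTorusElt (uniformizer_ne_zero hϖ) 1 (0 : Fin n → ℤ) : symplecticSimilitudeGroup (Fin n) K) =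
      ((fun _ : Fin n => (1 : ℤ)), 1) := by
  rw [similitudeIwasawaExp_similitudeTorusElt]
  refine Prod.ext (funext fun i => ?_) rfl
  simp

omit [Valued K ℤᵐ⁰] [NeZero n] in
/-- The matrix of `t(1, 0)` is `diag(ϖ, …, ϖ; 1, …, 1)` — Andrianov–Zhuravlev's `T(p) = (Γ diag(E, pE) Γ)` up to the Weyl
element `J`. [cite: AndrianovZhuravlev1995, Ch. 3 §3 (3.19), §3.3 Lemma 3.32] -/
theorem coe_coe_similitudeTorusElt_one_zero (hϖ0 : ϖ ≠ 0) :
    (((similitudeTorusElt hϖ0 1 (0 : Fin n → ℤ) : symplecticSimilitudeGroup (Fin n) K) : GL (Fin n ⊕ Fin n) K) :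
        Matrix (Fin n ⊕ Fin n) (Fin n ⊕ Fin n) K) = Matrix.diagonal (Sum.elim (fun _ : Fin n => ϖ) (fun _ : Fin n => (1 : K))) := by
  rw [coe_coe_similitudeTorusElt]
  congr 1
  funext s
  rcases s with i | i <;> simp

variable [IsHeckeTriple (⊤ : Submonoid (symplecticSimilitudeGroup (Fin n) K)) (symplecticSimilitudeInt (Fin n) K)
  (symplecticSimilitudeInt (Fin n) K)]

/-- **The top coefficient of `𝒮_q(T(p))`**: the coefficient of `x^{((1,…,1), 1)}` is `q^{⟨ρ, (1,…,1)⟩} = q^{n(n+1)/2}` (exactly one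
coset of `K₀ t(1,0) K₀` has the exponents of `t(1, 0)`). [cite: AndrianovZhuravlev1995, Ch. 3 §3.3 (3.70), Lemma 3.34]
[cite: BruhatTits1972, Prop. (4.4.4) (ii)] -/
theorem coeff_similitudeSatakeTransform_Tp_top (hϖ : Valued.v ϖ = WithZero.exp (-1 : ℤ)) (q : Rˣ) :
    (similitudeSatakeTransform hϖ q (heckeAlgebra.doubleCosetOperator (symplecticSimilitudeInt (Fin n) K)
      (similitudeTorusElt (uniformizer_ne_zero hϖ) 1 (0 : Fin n → ℤ) : symplecticSimilitudeGroup (Fin n) K))).coeff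
        ((fun _ : Fin n => (1 : ℤ)), 1) = ((q ^ symplecticRhoPairing (fun _ : Fin n => (1 : ℤ)) : Rˣ) : R) := by
  have h := coeff_self_similitudeSatakeTransform_torusElt hϖ q (m := 1) (a := fun _ : Fin n => (0 : ℤ)) (fun _ _ _ => le_rfl)
    (fun _ => by norm_num)
  simp only [add_zero] at h
  exact h

/-- **Exactly one coset of `K₀ t(1,0) K₀` has exponents `((1,…,1), 1)`.** [cite: BruhatTits1972, Prop. (4.4.4) (ii)]
[cite: AndrianovZhuravlev1995, Ch. 3 §3.3 Lemma 3.32] -/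
theorem card_filter_similitudeIwasawaExp_Tp_top (hϖ : Valued.v ϖ = WithZero.exp (-1 : ℤ))
    [DecidablePred fun γ : symplecticSimilitudeGroup (Fin n) K ⧸ symplecticSimilitudeInt (Fin n) K =>
      similitudeIwasawaExp hϖ γ.out = ((fun _ : Fin n => (1 : ℤ)), 1)] :
    ((finite_orbit_quotient (symplecticSimilitudeInt (Fin n) K)
        (similitudeTorusElt (uniformizer_ne_zero hϖ) 1 (0 : Fin n → ℤ) : symplecticSimilitudeGroup (Fin n) K)).toFinset.filter
        fun γ => similitudeIwasawaExp hϖ γ.out = ((fun _ : Fin n => (1 : ℤ)), 1)).card = 1 := by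
  classical
  have h := card_filter_similitudeIwasawaExp_orbit_eq_one (K := K) hϖ (m := 1) (a := fun _ : Fin n => (0 : ℤ))
    (fun _ _ _ => le_rfl) (fun _ => by norm_num)
  simp only [add_zero] at h
  convert h using 2

/-! ## §2 The coefficients of `𝒮_q(T(p))` at the `2ⁿ` exponents `(𝟙_I, 1)` -/

omit [Valued K ℤᵐ⁰] [NeZero n] [IsHeckeTriple (⊤ : Submonoid (symplecticSimilitudeGroup (Fin n) K)) (symplecticSimilitudeInt (Fin n) K)
  (symplecticSimilitudeInt (Fin n) K)] in
/-- The sign vector `ε_I` (`+1` on `I`, `-1` off `I`) moves the top exponent `((1,…,1), 1)` to `(𝟙_I, 1)`.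
[cite: AndrianovZhuravlev1995, Ch. 3 §3.3 (3.51)] -/
theorem similitudeSignedPermEquiv_indicator_apply_top (I : Finset (Fin n)) :
    similitudeSignedPermEquiv (fun i => if i ∈ I then (1 : ℤˣ) else -1) 1 ((fun _ : Fin n => (1 : ℤ)), 1) =
      ((fun i => if i ∈ I then (1 : ℤ) else 0), 1) := by
  rw [similitudeSignedPermEquiv_apply]
  refine Prod.ext (funext fun i => ?_) rfl
  dsimp only
  by_cases hi : i ∈ I
  · rw [if_pos hi, if_pos rfl, if_pos hi]
  · rw [if_neg hi, if_neg (by decide), if_neg hi, sub_self]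

variable [CompactSpace 𝒪[K]] [Finite 𝓀[K]]

/-- **`𝒮_q(T(p))_{(𝟙_I, 1)} = q^{⟨ρ, (1,…,1)⟩}` for every `I ⊆ {0, …, n-1}`** (Weyl-group invariance from the top coefficient:
`(𝟙_I, 1) = w_{ε_I} ((1,…,1), 1)`). [cite: AndrianovZhuravlev1995, Ch. 3 §3.3 (3.70), Lemma 3.34] [cite: CartierCorvallis1979, §IV Thm. 4.1 (b)] -/
theorem coeff_similitudeSatakeTransform_Tp_indicator (hϖ : Valued.v ϖ = WithZero.exp (-1 : ℤ)) (q : Rˣ)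
    (hq : (q : R) = Nat.card 𝓀[K]) (I : Finset (Fin n)) :
    (similitudeSatakeTransform hϖ q (heckeAlgebra.doubleCosetOperator (symplecticSimilitudeInt (Fin n) K)
      (similitudeTorusElt (uniformizer_ne_zero hϖ) 1 (0 : Fin n → ℤ) : symplecticSimilitudeGroup (Fin n) K))).coeff
        ((fun i => if i ∈ I then (1 : ℤ) else 0), 1) = ((q ^ symplecticRhoPairing (fun _ : Fin n => (1 : ℤ)) : Rˣ) : R) := by
  rw [← similitudeSignedPermEquiv_indicator_apply_top I, coeff_similitudeSatakeTransform_signedPerm hϖ q hq,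
    coeff_similitudeSatakeTransform_Tp_top]

/-- **The support of `𝒮_q(T(p))` is contained in `{(𝟙_I, 1)}`**: if `x^{(μ, c)}` occurs then `c = 1` and every `μ_i ∈ {0, 1}`
(multiplier part; then `μ_i ≤ 1` by triangularity after permuting `i` to the front, and `μ_i ≥ 0` by the same after `τ_i`).
[cite: AndrianovZhuravlev1995, Ch. 3 §3.3 (3.58)–(3.59), Lemma 3.32, (3.70)] [cite: BruhatTits1972, Prop. (4.4.4) (i)] -/
theorem eq_of_coeff_similitudeSatakeTransform_Tp_ne_zero (hϖ : Valued.v ϖ = WithZero.exp (-1 : ℤ)) (q : Rˣ)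
    (hq : (q : R) = Nat.card 𝓀[K]) {μ : Fin n → ℤ} {c : ℤ}
    (h : (similitudeSatakeTransform hϖ q (heckeAlgebra.doubleCosetOperator (symplecticSimilitudeInt (Fin n) K)
      (similitudeTorusElt (uniformizer_ne_zero hϖ) 1 (0 : Fin n → ℤ) : symplecticSimilitudeGroup (Fin n) K))).coeff (μ, c) ≠ 0) :
    c = 1 ∧ ∀ i, μ i = 0 ∨ μ i = 1 := by
  have hc : c = 1 := snd_eq_of_coeff_similitudeSatakeTransform_ne_zero hϖ q 1 0 h
  subst hc
  refine ⟨rfl, fun i => ?_⟩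
  -- `μ_i ≤ 1`: permute `i` to position `0` and read the first head sum
  have hle : ∀ (ν : Fin n → ℤ), (similitudeSatakeTransform hϖ q (heckeAlgebra.doubleCosetOperator (symplecticSimilitudeInt (Fin n) K)
      (similitudeTorusElt (uniformizer_ne_zero hϖ) 1 (0 : Fin n → ℤ) : symplecticSimilitudeGroup (Fin n) K))).coeff (ν, 1) ≠ 0 →
      ν i ≤ 1 := by
    intro ν hν
    have hν' := hν
    rw [← coeff_similitudeSatakeTransform_comp_perm hϖ q hq _ (Equiv.swap 0 i) ν 1] at hν'
    have hs := headSum_le_of_coeff_similitudeSatakeTransform_ne_zero hϖ q (m := 1) (a := fun _ : Fin n => (0 : ℤ))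
      (fun _ _ _ => le_rfl) (fun _ => by norm_num) hν' 1
    rw [sum_ite_lt_one_eq, sum_ite_lt_one_eq] at hs
    simpa [Function.comp, Equiv.swap_apply_left] using hs
  have h1 : μ i ≤ 1 := hle μ h
  -- `μ_i ≥ 0`: apply `τ_i` first
  have h2 : 1 - μ i ≤ 1 := by
    have hτ := h
    rw [← coeff_similitudeSatakeTransform_tau hϖ q hq _ i μ 1] at hτ
    have := hle _ hτ
    rwa [Function.update_self] at this
  omega

/-- **`𝒮_q(T(p))` vanishes off the exponents `(𝟙_I, 1)`.** [cite: AndrianovZhuravlev1995, Ch. 3 §3.3 (3.70)] -/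
theorem coeff_similitudeSatakeTransform_Tp_eq_zero (hϖ : Valued.v ϖ = WithZero.exp (-1 : ℤ)) (q : Rˣ)
    (hq : (q : R) = Nat.card 𝓀[K]) {μ : Fin n → ℤ} {c : ℤ} (hμc : c ≠ 1 ∨ ∃ i, μ i ≠ 0 ∧ μ i ≠ 1) :
    (similitudeSatakeTransform hϖ q (heckeAlgebra.doubleCosetOperator (symplecticSimilitudeInt (Fin n) K)
      (similitudeTorusElt (uniformizer_ne_zero hϖ) 1 (0 : Fin n → ℤ) : symplecticSimilitudeGroup (Fin n) K))).coeff (μ, c) = 0 := by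
  by_contra h
  obtain ⟨hc, hμ⟩ := eq_of_coeff_similitudeSatakeTransform_Tp_ne_zero hϖ q hq h
  rcases hμc with hc' | ⟨i, hi0, hi1⟩
  · exact hc' hc
  · rcases hμ i with h' | h'
    · exact hi0 h'
    · exact hi1 h'

/-! ## §3 `𝒮_q(T(p)) = q^{n(n+1)/2} · x_0 ∏_i (1 + x_i)` (Andrianov–Zhuravlev (3.70): `Ω(T(p)) = x_0 ∏ (1 + x_i) = t`) -/

omit [Valued K ℤᵐ⁰] [NeZero n] [IsHeckeTriple (⊤ : Submonoid (symplecticSimilitudeGroup (Fin n) K)) (symplecticSimilitudeInt (Fin n) K)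
  (symplecticSimilitudeInt (Fin n) K)] [CompactSpace 𝒪[K]] [Finite 𝓀[K]] in
/-- `∑_{i ∈ I} e_i = 𝟙_I` in `ℤⁿ`. [folklore] -/
private theorem sum_pi_single_one_eq_indicator (I : Finset (Fin n)) :
    (∑ i ∈ I, (Pi.single i (1 : ℤ) : Fin n → ℤ)) = fun j => if j ∈ I then (1 : ℤ) else 0 := by
  funext j
  rw [Finset.sum_apply]
  simp only [Pi.single_apply]
  rw [Finset.sum_ite_eq]

omit [Valued K ℤᵐ⁰] [NeZero n] [IsHeckeTriple (⊤ : Submonoid (symplecticSimilitudeGroup (Fin n) K)) (symplecticSimilitudeInt (Fin n) K)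
  (symplecticSimilitudeInt (Fin n) K)] [CompactSpace 𝒪[K]] [Finite 𝓀[K]] in
/-- **`x_0 ∏_i (1 + x_i) = ∑_{I} x^{(𝟙_I, 1)}`** in `R[ℤⁿ × ℤ]` (`x_0 = x^{(0, 1)}`, `x_i = x^{(e_i, 0)}`; A–Z's
`t = Σ_a x_0 s_a(x_1, …, x_n)`). [cite: AndrianovZhuravlev1995, Ch. 3 §3.3 (3.54), (3.70)] -/
theorem single_zero_one_mul_prod_one_add_single (r : R) :
    AddMonoidAlgebra.single (((0 : Fin n → ℤ)), (1 : ℤ)) r *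
        ∏ i : Fin n, (1 + AddMonoidAlgebra.single ((Pi.single i (1 : ℤ) : Fin n → ℤ), (0 : ℤ)) (1 : R)) =
      ∑ I : Finset (Fin n), AddMonoidAlgebra.single ((fun j => if j ∈ I then (1 : ℤ) else 0), (1 : ℤ)) r := by
  rw [Finset.prod_one_add, Finset.powerset_univ, Finset.mul_sum]
  refine Finset.sum_congr rfl fun I _ => ?_
  rw [AddMonoidAlgebra.prod_single, Finset.prod_const_one, AddMonoidAlgebra.single_mul_single, mul_one]
  congr 1
  refine Prod.ext ?_ ?_
  · rw [Prod.fst_add, Prod.fst_sum, zero_add, sum_pi_single_one_eq_indicator]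
  · rw [Prod.snd_add, Prod.snd_sum, Finset.sum_const_zero, add_zero]

/-- **ANDRIANOV–ZHURAVLEV (3.70) FOR EVERY RANK AND EVERY COEFFICIENT RING**: in the tree's normalisation (`𝒮_q`, weight
`q^{⟨ρ, a⟩}`), **`𝒮_q(T(p)) = q^{⟨ρ,(1,…,1)⟩} · x_0 ∏_{i} (1 + x_i) = q^{n(n+1)/2} Σ_{I ⊆ [n]} x^{(𝟙_I, 1)}`**, where
`T(p) = T_{t(1,0)} = [K₀ diag(ϖ·1; 1) K₀]`, `x_0 = x^{(0,1)}`, `x_i = x^{(e_i, 0)}` — A–Z's `Ω(T(p)) = x_0 Π_{i=1}^n (1 + x_i) = t`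
(their `Ω` carries the extra factor `p^{-⟨n⟩}`-type normalisation (3.46)–(3.49)).  Here from the Weyl-group invariance (g51-#2)
and the one-coset top term, instead of A–Z's left-coset expansion (3.58)–(3.59). [cite: AndrianovZhuravlev1995, Ch. 3 §3.3 (3.58)–(3.59), Lemma 3.32–3.34, (3.70)]
[cite: CartierCorvallis1979, §IV Thm. 4.1 (b)] -/
theorem similitudeSatakeTransform_Tp (hϖ : Valued.v ϖ = WithZero.exp (-1 : ℤ)) (q : Rˣ) (hq : (q : R) = Nat.card 𝓀[K]) :
    similitudeSatakeTransform hϖ q (heckeAlgebra.doubleCosetOperator (symplecticSimilitudeInt (Fin n) K)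
      (similitudeTorusElt (uniformizer_ne_zero hϖ) 1 (0 : Fin n → ℤ) : symplecticSimilitudeGroup (Fin n) K)) =
      AddMonoidAlgebra.single (((0 : Fin n → ℤ)), (1 : ℤ)) ((q ^ symplecticRhoPairing (fun _ : Fin n => (1 : ℤ)) : Rˣ) : R) *
        ∏ i : Fin n, (1 + AddMonoidAlgebra.single ((Pi.single i (1 : ℤ) : Fin n → ℤ), (0 : ℤ)) (1 : R)) := by
  classical
  rw [single_zero_one_mul_prod_one_add_single]
  refine AddMonoidAlgebra.ext (Finsupp.ext fun μc => ?_)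
  obtain ⟨μ, c⟩ := μc
  rw [AddMonoidAlgebra.coeff_sum, Finset.sum_apply']
  simp only [AddMonoidAlgebra.coeff_single, Finsupp.single_apply, Prod.mk.injEq]
  by_cases hμc : c = 1 ∧ ∀ i, μ i = 0 ∨ μ i = 1
  · obtain ⟨rfl, hμ⟩ := hμc
    have hI : (fun j => if j ∈ (Finset.univ.filter fun j => μ j = 1) then (1 : ℤ) else 0) = μ := by
      funext j
      rcases hμ j with h | h <;> simp [h]
    rw [Finset.sum_eq_single (Finset.univ.filter fun j => μ j = 1)]
    · rw [if_pos ⟨hI, rfl⟩, ← hI, coeff_similitudeSatakeTransform_Tp_indicator hϖ q hq]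
    · intro I _ hI'
      rw [if_neg]
      rintro ⟨hIμ, -⟩
      refine hI' ?_
      ext j
      rw [Finset.mem_filter, ← hIμ]
      simp
    · intro h; exact absurd (Finset.mem_univ _) h
  · rw [coeff_similitudeSatakeTransform_Tp_eq_zero hϖ q hq (by
      by_cases hc : c = 1
      · right
        by_contra hall
        refine hμc ⟨hc, fun i => ?_⟩
        by_contra hi
        exact hall ⟨i, fun h0 => hi (Or.inl h0), fun h1 => hi (Or.inr h1)⟩
      · exact Or.inl hc)]
    symm
    refine Finset.sum_eq_zero fun I _ => ?_
    rw [if_neg]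
    rintro ⟨hIμ, hc⟩
    refine hμc ⟨hc.symm, fun i => ?_⟩
    rw [← hIμ]
    by_cases hi : i ∈ I
    · right; simp only [if_pos hi]
    · left; simp only [if_neg hi]

/-! ## §4 The left-coset counts `N(𝟙_I, 1) = q^{Σ_{i ∉ I} (n - i)}` and the degree `deg T(p) = ∏_{j=1}^{n} (1 + q^j)` -/

omit [Valued K ℤᵐ⁰] [NeZero n] [IsHeckeTriple (⊤ : Submonoid (symplecticSimilitudeGroup (Fin n) K)) (symplecticSimilitudeInt (Fin n) K)
  (symplecticSimilitudeInt (Fin n) K)] [CompactSpace 𝒪[K]] [Finite 𝓀[K]] in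
/-- `⟨ρ, (1,…,1)⟩ - ⟨ρ, 𝟙_I⟩ = Σ_{i ∉ I} (n - i)`. [cite: CartierCorvallis1979, §IV (4.2)] -/
theorem symplecticRhoPairing_one_sub_indicator (I : Finset (Fin n)) :
    symplecticRhoPairing (fun _ : Fin n => (1 : ℤ)) - symplecticRhoPairing (fun i => if i ∈ I then (1 : ℤ) else 0) =
      ((∑ i ∈ Iᶜ, (n - (i : ℕ)) : ℕ) : ℤ) := by
  classical
  simp only [symplecticRhoPairing, mul_one, ← Finset.sum_sub_distrib]
  rw [Nat.cast_sum, ← Finset.sum_compl_add_sum I]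
  have h1 : ∑ i ∈ I, (((n : ℤ) - (i : ℕ)) - ((n : ℤ) - (i : ℕ)) * (if i ∈ I then (1 : ℤ) else 0)) = 0 :=
    Finset.sum_eq_zero fun i hi => by rw [if_pos hi, mul_one, sub_self]
  rw [h1, add_zero]
  refine Finset.sum_congr rfl fun i hi => ?_
  rw [Finset.mem_compl] at hi
  rw [if_neg hi, mul_zero, sub_zero, Nat.cast_sub i.isLt.le]

/-- **THE LEFT-COSET COUNTS OF `T(p)`**: the number of cosets `γ K₀ ⊆ K₀ t(1,0) K₀` with exponents `(𝟙_I, 1)` is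
**`q^{Σ_{i ∉ I} (n - i)}`** (`q = #𝓀`; e.g. `I = ∅`: `q^{n(n+1)/2}` cosets `(E B; 0 pE)`, `B = ᵗB mod p`; `I = [n]`: the single
coset of `t(1,0)`) — from the counting identity of `SymplecticSimilitudeSatakeWeylInvariance` at the top exponent (A–Z (3.58)–(3.59)
with Lemma 3.33: `b_0(D_a) = p^{⟨a⟩}`). [cite: AndrianovZhuravlev1995, Ch. 3 §3.3 (3.58)–(3.59), Lemma 3.32, Lemma 3.33, Lemma 3.34] -/
theorem card_filter_similitudeIwasawaExp_Tp_indicator (hϖ : Valued.v ϖ = WithZero.exp (-1 : ℤ)) (I : Finset (Fin n))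
    [DecidablePred fun γ : symplecticSimilitudeGroup (Fin n) K ⧸ symplecticSimilitudeInt (Fin n) K =>
      similitudeIwasawaExp hϖ γ.out = ((fun i => if i ∈ I then (1 : ℤ) else 0), 1)] :
    ((finite_orbit_quotient (symplecticSimilitudeInt (Fin n) K)
        (similitudeTorusElt (uniformizer_ne_zero hϖ) 1 (0 : Fin n → ℤ) : symplecticSimilitudeGroup (Fin n) K)).toFinset.filter
        fun γ => similitudeIwasawaExp hϖ γ.out = ((fun i => if i ∈ I then (1 : ℤ) else 0), 1)).card =
      Nat.card 𝓀[K] ^ (∑ i ∈ Iᶜ, (n - (i : ℕ))) := by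
  classical
  have h := card_filter_similitudeIwasawaExp_signedPerm_mul_pow_eq hϖ
    (similitudeTorusElt (uniformizer_ne_zero hϖ) 1 (0 : Fin n → ℤ) : symplecticSimilitudeGroup (Fin n) K)
    (fun i => if i ∈ I then (1 : ℤˣ) else -1) 1 ((fun _ : Fin n => (1 : ℤ)), 1)
  simp only [similitudeSignedPermEquiv_indicator_apply_top] at h
  rw [card_filter_similitudeIwasawaExp_Tp_top hϖ, one_mul, symplecticRhoPairing_one_sub_indicator, Int.toNat_natCast,
    show (symplecticRhoPairing (fun i => if i ∈ I then (1 : ℤ) else 0) - symplecticRhoPairing fun _ : Fin n => (1 : ℤ)).toNat = 0 from by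
      rw [Int.toNat_eq_zero, sub_nonpos, ← sub_nonneg, symplecticRhoPairing_one_sub_indicator]; positivity,
    pow_zero, mul_one] at h
  convert h using 2

/-- **Every coset of `K₀ t(1,0) K₀` has exponents `(𝟙_I, 1)` for some `I`** (`I = {i : a(γ)_i = 1}`).
[cite: AndrianovZhuravlev1995, Ch. 3 §3.3 (3.58)–(3.59), Lemma 3.32] -/
theorem similitudeIwasawaExp_out_eq_indicator_of_mem_orbit_Tp (hϖ : Valued.v ϖ = WithZero.exp (-1 : ℤ))
    {γ : symplecticSimilitudeGroup (Fin n) K ⧸ symplecticSimilitudeInt (Fin n) K}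
    (hγ : γ ∈ orbit (symplecticSimilitudeInt (Fin n) K)
      ((similitudeTorusElt (uniformizer_ne_zero hϖ) 1 (0 : Fin n → ℤ) : symplecticSimilitudeGroup (Fin n) K) :
        symplecticSimilitudeGroup (Fin n) K ⧸ symplecticSimilitudeInt (Fin n) K)) :
    similitudeIwasawaExp hϖ γ.out =
      ((fun i => if i ∈ Finset.univ.filter (fun i => (similitudeIwasawaExp hϖ γ.out).1 i = 1) then (1 : ℤ) else 0), 1) := by
  classical
  -- over `ℚ` with `q = #𝓀` the coefficient of `x^{(a,c)(γ)}` in `𝒮_q(T(p))` is `N · q^e ≠ 0` (`γ` itself is counted)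
  have hqN : (Nat.card 𝓀[K] : ℚ) ≠ 0 := by exact_mod_cast (natCard_residueField_pos (K := K)).ne'
  set q : ℚˣ := Units.mk0 (Nat.card 𝓀[K] : ℚ) hqN with hqdef
  have hq : (q : ℚ) = Nat.card 𝓀[K] := rfl
  have hne : (similitudeSatakeTransform hϖ q (heckeAlgebra.doubleCosetOperator (symplecticSimilitudeInt (Fin n) K)
      (similitudeTorusElt (uniformizer_ne_zero hϖ) 1 (0 : Fin n → ℤ) : symplecticSimilitudeGroup (Fin n) K))).coeff
      ((similitudeIwasawaExp hϖ γ.out).1, (similitudeIwasawaExp hϖ γ.out).2) ≠ 0 := by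
    rw [coeff_similitudeSatakeTransform_doubleCosetOperator]
    refine mul_ne_zero ?_ (Units.ne_zero _)
    rw [Nat.cast_ne_zero, ← Nat.pos_iff_ne_zero, Finset.card_pos]
    exact ⟨γ, Finset.mem_filter.2 ⟨(Set.Finite.mem_toFinset _).2 hγ, rfl⟩⟩
  obtain ⟨hc, hμ⟩ := eq_of_coeff_similitudeSatakeTransform_Tp_ne_zero hϖ q hq hne
  refine Prod.ext (funext fun i => ?_) hc
  rcases hμ i with h | h <;> simp [h]

omit [Valued K ℤᵐ⁰] [NeZero n] [IsHeckeTriple (⊤ : Submonoid (symplecticSimilitudeGroup (Fin n) K)) (symplecticSimilitudeInt (Fin n) K)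
  (symplecticSimilitudeInt (Fin n) K)] [CompactSpace 𝒪[K]] [Finite 𝓀[K]] in
/-- `Σ_{I} q^{Σ_{i ∉ I}(n - i)} = ∏_{j=1}^{n} (1 + q^j)`. [cite: AndrianovZhuravlev1995, Ch. 3 §3.3 Lemma 3.33] -/
theorem sum_pow_sum_compl_eq_prod (q : ℕ) :
    (∑ I : Finset (Fin n), q ^ (∑ i ∈ Iᶜ, (n - (i : ℕ)))) = ∏ j : Fin n, (1 + q ^ ((j : ℕ) + 1)) := by
  classical
  have h1 : (∑ I : Finset (Fin n), q ^ (∑ i ∈ Iᶜ, (n - (i : ℕ)))) = ∑ J : Finset (Fin n), ∏ i ∈ J, q ^ (n - (i : ℕ)) := by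
    refine Fintype.sum_bijective (fun I : Finset (Fin n) => Iᶜ) compl_involutive.bijective _ _ fun I => ?_
    rw [Finset.prod_pow_eq_pow_sum]
  have h2 : (∏ j : Fin n, (1 + q ^ ((j : ℕ) + 1))) = ∏ i : Fin n, (1 + q ^ (n - (i : ℕ))) := by
    refine (Fintype.prod_equiv Fin.revPerm _ _ fun i => ?_).symm
    rw [Fin.revPerm_apply, Fin.val_rev]
    congr 2
    have := i.isLt
    omega
  rw [h1, h2, Finset.prod_one_add, Finset.powerset_univ]

/-- **THE DEGREE OF `T(p)`: `#(K₀ t(1,0) K₀ / K₀) = ∏_{j=1}^{n} (1 + q^j)`** (`q = #𝓀`) — the number of left cosets in the double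
coset of `diag(ϖ·1; 1)` in `GSp_{2n}` (`n = 1`: `1 + q`; `n = 2`: `(1+q)(1+q²)`): the cosets are sorted by their exponents
`(𝟙_I, 1)` and counted by `card_filter_similitudeIwasawaExp_Tp_indicator`. [cite: AndrianovZhuravlev1995, Ch. 3 §3.3 (3.58)–(3.59), Lemma 3.32, Lemma 3.33]
[cite: ShimuraIATAF1971, Prop. 3.15] -/
theorem card_orbit_Tp (hϖ : Valued.v ϖ = WithZero.exp (-1 : ℤ)) :
    (finite_orbit_quotient (symplecticSimilitudeInt (Fin n) K)
        (similitudeTorusElt (uniformizer_ne_zero hϖ) 1 (0 : Fin n → ℤ) : symplecticSimilitudeGroup (Fin n) K)).toFinset.card =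
      ∏ j : Fin n, (1 + Nat.card 𝓀[K] ^ ((j : ℕ) + 1)) := by
  classical
  set S := (finite_orbit_quotient (symplecticSimilitudeInt (Fin n) K)
    (similitudeTorusElt (uniformizer_ne_zero hϖ) 1 (0 : Fin n → ℤ) : symplecticSimilitudeGroup (Fin n) K)).toFinset with hS
  have hmaps : (S : Set (symplecticSimilitudeGroup (Fin n) K ⧸ symplecticSimilitudeInt (Fin n) K)).MapsTo
      (fun γ => similitudeIwasawaExp hϖ γ.out)
      ((Finset.univ : Finset (Finset (Fin n))).image fun I => ((fun i => if i ∈ I then (1 : ℤ) else 0), (1 : ℤ))) := by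
    intro γ hγ
    rw [hS, Finset.mem_coe, Set.Finite.mem_toFinset] at hγ
    rw [Finset.coe_image, Finset.coe_univ, Set.image_univ, Set.mem_range]
    exact ⟨_, (similitudeIwasawaExp_out_eq_indicator_of_mem_orbit_Tp hϖ hγ).symm⟩
  rw [Finset.card_eq_sum_card_fiberwise hmaps, Finset.sum_image fun I _ J _ h => ?_]
  · rw [← sum_pow_sum_compl_eq_prod]
    refine Finset.sum_congr rfl fun I _ => ?_
    rw [hS]
    convert card_filter_similitudeIwasawaExp_Tp_indicator hϖ I using 2
  · have h1 := congrArg Prod.fst h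
    ext i
    have hi := congrFun h1 i
    by_cases hI : i ∈ I <;> by_cases hJ : i ∈ J <;> simp_all

/-- **The degree character on `T(p)`**: at `q = 1`, `χ = 1` the eigenvalue of `T(p)` is `∏_{j=1}^{n} (1 + q^j)` in `R`.
[cite: AndrianovZhuravlev1995, Ch. 3 §3.3 Prop. 3.36] [cite: CartierCorvallis1979, §IV (4.2)] -/
theorem similitudeHeckeEigencharacter_one_one_Tp (hϖ : Valued.v ϖ = WithZero.exp (-1 : ℤ)) :
    similitudeHeckeEigencharacter (R := R) hϖ 1 1 (heckeAlgebra.doubleCosetOperator (symplecticSimilitudeInt (Fin n) K)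
      (similitudeTorusElt (uniformizer_ne_zero hϖ) 1 (0 : Fin n → ℤ) : symplecticSimilitudeGroup (Fin n) K)) =
      ∏ j : Fin n, (1 + (Nat.card 𝓀[K] : R) ^ ((j : ℕ) + 1)) := by
  rw [similitudeHeckeEigencharacter_one_one_doubleCosetOperator, card_orbit_Tp hϖ]
  push_cast
  rfl

end Literature.NumberTheory.Automorphic.SymplecticCartan

end
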